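import Summits.BirchSwinnertonDyer.BirchSwinnertonDyer.Theorems.SmallImageMuTransferMuTransferX9LocalQTermAdapter
import Summits.BirchSwinnertonDyer.BirchSwinnertonDyer.Theorems.ByReductionTypeAtTwoOrdKatoHalfAtTwoIsoPortRealPlace
import Summits.BirchSwinnertonDyer.BirchSwinnertonDyer.Theorems.ByReductionTypeAtTwoOrdKatoHalfAtTwoIsoSteinbergSahTwist
import Literature.NumberTheory.EllipticCurves.ArchimedeanWeilPairingDuality
import HarnessLib

/-!
# Route `ByReductionTypeAtTwo`, crux `OrdKatoHalfAtTwoIso` (stmt-BirchSwinnertonDyer-19573), line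
# `steinberg-fibre-at-two` (skeleton v5): helper W4b, file 1/2 — VALUES of local cocycles of the twist
# `𝒯_J` at a SHALLOW prime (`J ≤ p^m`, `Fr_q ∈ Γ^{p^m}`) and the `E[2]`-dictionary of a TRANSPOSITION

HONEST FRAMING (cell bsd-2adic): BSD is not proved by any of this; the crux `OrdKatoHalfAtTwoIso` is NOT
proved here; none of the line's registered stubs is proved here; nothing is booked.  KERNEL HELPER
(`--supports … --as helper`) toward step M3 = K4-local («the `q`-term identity at a transposition prime»)
of the registered stub `stub_HK_kolyvaginRankOneTwo` (Ω road; credit: scrit STUB-PLAN F4/K4, sidea-2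
card #9).  It replaces, at `p = 2`, the VALUE half of the odd core's `E`-split `LocalQTerm` family
(`…X9LocalSplitValues`: there the admissible values at a tame generator are `𝒯_J[T^{p^m}]`; here, at a
prime whose Frobenius lies in `Γ^{p^m}` with `J ≤ p^m`, the twist is INVISIBLE and the admissible values
are the slotwise fixed vectors of `ρ(Fr)`).  TOOL theorems only (no definition, no named fact, no
`sorry`); nothing is asserted about any curve.

## Content
* §1 (generic: number field `K`, prime `p`, `ρ` unramified at `q ∤ p`, `p ∣ N(q) − 1`, `χ̄_ℓ` onto on
  inertia; `J ≤ p^m`, `res Fr ∈ Γ_m`): `toLocal_twistModP_apply_of_mem_layerSubgroup_of_le` (the local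
  twist acts SLOTWISE through `ρ`), `forall_toLocal_twistModP_apply_eq_self_iff_of_le`
  (`(𝒯_J|_q)^{Γ_{K_q}} = {x | ρ(res Fr) x_i = x_i ∀ i}`), `cocycle_apply_slot_eq_self` (the value of ANY
  cocycle at an inertia element is slotwise `ρ(res Fr)`-fixed), `exists_transverse_cocycle_apply_eq_of_forall`
  (a TRANSVERSE class with any prescribed slotwise-fixed value at the tame generator `t₀`),
  `mem_unramifiedSubgroup_of_apply_eq_zero` (a class vanishing at `t₀` is UNRAMIFIED — no transversality).
* §2 (`E/ℚ`, `p = 2`, `g ∈ Γ_ℚ` with `ρ̄₂(g) ≠ 1`, `ρ̄₂(g²) = 1` — a TRANSPOSITION of `{T₀, T₁, T₂}`):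
  `exists_fixedPoint_of_transposition` (`ker(g − 1) = {0, P₀} ⊇ im(g − 1) ∋ P₀`),
  `weilPairingHom_eq_zero_iff_smul_eq_of_transposition` (`e(P₀, b) = 0 ↔ g b = b`), and the curve-level
  value lemmas `exists_cocycle_apply_eq_smul_sub_two` / `exists_transverse_cocycle_apply_eq_smul_sub_two`
  (every local cocycle of `𝒯_J(E)|_q` has `t₀`-value `(g − 1)v`, and every `(g − 1)v` is the `t₀`-value
  of a transverse class).

References: B. Mazur, K. Rubin, Mem. AMS 799 (2004) §1.2, Prop. 1.3.2 [MazurRubin2004]; K. Rubin,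
*Euler Systems* (2000) Lemma 1.4.7, Thm. 4.5.4 [Rubin2000]; K. Rubin, PCMI 18 (2011) Prop. 1.9.5
[Rubin2011]; L. C. Washington, GTM 83, §13.1–§13.2 [Washington1997]; J. H. Silverman, *AEC* (2009)
III.6.4, III.8.1 [SilvermanAEC2009].
-/

set_option autoImplicit false
set_option linter.dupNamespace false

noncomputable section

open scoped Classical ContRepresentation
open CategoryTheory ContinuousCohomology Function Field ValuativeRel NumberField IsDedekindDomain Finset
open WeierstrassCurve
open Literature.NumberTheory.GaloisRepresentations
open Literature.NumberTheory.GaloisRepresentations.IsNonarchimedeanLocalField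
open _root_.TopRep
open Literature.NumberTheory.GaloisCohomology
open Literature.NumberTheory.EllipticCurves
open Literature.NumberTheory.EllipticCurves.DokchitserDokchitser2012
open Summit.BirchSwinnertonDyer.Rank1Residual.GaloisImage
open Summit.BirchSwinnertonDyer.Rank1Residual (X11b.LocBridge.mem_unramifiedSubgroup_one_iff_forall_eq_zero)
open Summit.BirchSwinnertonDyer.BirchSwinnertonDyer.Rank1Residual
open Summit.BirchSwinnertonDyer.BirchSwinnertonDyer.Rank1Residual.LocalSplitPrime

universe u

namespace Summit.BirchSwinnertonDyer.BirchSwinnertonDyer.Theorems.SteinbergFibreAtTwo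

/-! ## §1 Generic: the local twist at a SHALLOW prime (`J ≤ p^m`, `res Fr ∈ Γ_m`) -/

section Generic

variable {F : Type u} [Field F] [ValuativeRel F] [TopologicalSpace F] [IsNonarchimedeanLocalField F]
  {M : Type u} [AddCommGroup M] [TopologicalSpace M] [DiscreteTopology M] [Finite M]
  (ρF : DiscreteGaloisModule F M) (ℓ : ℕ) [Fact ℓ.Prime] [NeZero (ℓ : F)]

/-- **A class vanishing at a tame generator is unramified** (no transversality needed): if `χ̄_ℓ(t₀)`
generates `(ℤ/ℓ)ˣ`, the inertia group acts trivially on `M`, `(ℓ − 1)M = 0` and `φ(t₀) = 0`, then `φ`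
vanishes on all of `I_F` (its restriction factors through `χ̄_ℓ`), i.e. `[φ] ∈ H¹_ur`.
[cite: Rubin2011, Prop. 1.9.5 (1) (p. 16)] [cite: MazurRubin2004, Lemma 1.2.1] -/
theorem mem_unramifiedSubgroup_of_apply_eq_zero (hchar : ringChar 𝓀[F] = ℓ)
    (hI : ∀ t ∈ absInertia F, ∀ m : M, ρF t m = m) (hM : ∀ m : M, (ℓ - 1) • m = 0)
    (hχI : ∀ u : (ZMod ℓ)ˣ, ∃ t ∈ absInertia F, modPCyclotomicCharacterZMod F ℓ t = u)
    {t₀ : absoluteGaloisGroup F} (ht₀ : t₀ ∈ absInertia F)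
    (hgen : ∀ u : (ZMod ℓ)ˣ, u ∈ Subgroup.zpowers (modPCyclotomicCharacterZMod F ℓ t₀))
    (φ : contOneCocycles ρF.toTopRep) (h0 : φ.1 t₀ = 0) :
    oneCocycleClass ρF.toTopRep φ ∈ DiscreteGaloisModule.unramifiedSubgroup ρF 1 := by
  set χ := modPCyclotomicCharacterZMod F ℓ
  have hpow : ∀ n : ℕ, φ.1 (t₀ ^ n) = 0 := fun n => by
    induction n with
    | zero => rw [pow_zero]; exact contOneCocycles.apply_one φ
    | succ n ih => rw [pow_succ, cocycle_apply_mul_of_mem_absInertia ρF hI φ ((absInertia F).pow_mem ht₀ n),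
        ih, h0, add_zero]
  have hzpow : ∀ n : ℤ, φ.1 (t₀ ^ n) = 0 := fun n => by
    cases n with
    | ofNat n => rw [Int.ofNat_eq_natCast, zpow_natCast]; exact hpow n
    | negSucc n =>
      rw [zpow_negSucc, cocycle_apply_inv_of_mem_absInertia ρF hI φ ((absInertia F).pow_mem ht₀ _),
        hpow, neg_zero]
  have hIvan : ∀ t ∈ absInertia F, φ.1 t = 0 := fun t ht => by
    obtain ⟨n, hn⟩ := Subgroup.mem_zpowers_iff.1 (hgen (χ t))
    rw [cocycle_apply_eq_of_mem_absInertia_of_chi_eq ρF ℓ hchar hI hM hχI φ ht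
      ((absInertia F).zpow_mem ht₀ n) (by rw [map_zpow]; exact hn.symm)]
    exact hzpow n
  exact (X11b.LocBridge.mem_unramifiedSubgroup_one_iff_forall_eq_zero ρF hI φ).2 hIvan

end Generic

section Shallow

variable {K : Type u} [Field K] [NumberField K] {p : ℕ} [Fact p.Prime]
  {M : Type u} [AddCommGroup M] [TopologicalSpace M] [DiscreteTopology M]
  (ρ : DiscreteGaloisModule K M) (hM : ∀ x : M, p • x = 0) (κ : ZpExtension K p) (J : ℕ)
  (q : HeightOneSpectrum (𝓞 K))

/-- **At a shallow element the twist is invisible**: if `J ≤ p^m` and `res g ∈ Γ_m = Gal(K̄/K_m)`, the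
local twist `𝒯_J|_q` acts through `ρ` SLOTWISE, `g·x = (ρ(res g) x_i)_i` (no `m ≤ J` needed: for
`J < m` pass to the layer `J`). [cite: Washington1997, §13.1–§13.2] -/
theorem toLocal_twistModP_apply_of_mem_layerSubgroup_of_le {m : ℕ} (hJm : J ≤ p ^ m)
    {g : absoluteGaloisGroup (q.adicCompletion K)}
    (hg : absGaloisRestrict K (q.adicCompletion K) g ∈ κ.layerSubgroup m) (x : Fin J → M) :
    GaloisRep.toLocal q (κ.twistModP ρ hM J) g x =
      fun i => ρ (absGaloisRestrict K (q.adicCompletion K) g) (x i) := by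
  rw [GaloisRep.toLocal_apply]
  rcases le_total m J with hmJ | hJm'
  · exact ZpExtension.twistModP_apply_of_mem_layerSubgroup κ _ _ J hmJ hJm hg x
  · exact ZpExtension.twistModP_apply_of_mem_layerSubgroup κ _ _ J le_rfl
      (Nat.lt_pow_self (Fact.out : p.Prime).one_lt).le (κ.layerSubgroup_antitone hJm' hg) x

/-- **`(𝒯_J|_q)^{Γ_{K_q}}` at a shallow prime = the slotwise `ρ(res Fr)`-fixed vectors** (`q ∤ p`, `ρ`
unramified at `q`, `Fr` a Frobenius of `K_q`, `J ≤ p^m`, `res Fr ∈ Γ_m`): inertia acts trivially, so the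
invariants are the fixed points of `Fr` (`forall_apply_eq_iff_of_isFrobPow`), and `Fr` acts slotwise.
[cite: MazurRubin2004, Lemma 1.2.1] [cite: Washington1997, §13.1–§13.2] -/
theorem forall_toLocal_twistModP_apply_eq_self_iff_of_le (hunr : GaloisRep.IsUnramifiedAt q ρ)
    (hqp : (p : 𝓞 K) ∉ q.asIdeal) {Fr : absoluteGaloisGroup (q.adicCompletion K)} (hFr : IsFrobPow Fr 1)
    {m : ℕ} (hJm : J ≤ p ^ m) (hFrm : absGaloisRestrict K (q.adicCompletion K) Fr ∈ κ.layerSubgroup m)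
    (x : Fin J → M) :
    (∀ g : absoluteGaloisGroup (q.adicCompletion K), GaloisRep.toLocal q (κ.twistModP ρ hM J) g x = x) ↔
      ∀ i, ρ (absGaloisRestrict K (q.adicCompletion K) Fr) (x i) = x i := by
  have hI : ∀ t ∈ absInertia (q.adicCompletion K), ∀ y : Fin J → M,
      GaloisRep.toLocal q (κ.twistModP ρ hM J) t y = y :=
    fun _ ht y => toLocal_twistModP_apply_of_mem_absInertia ρ hM κ J q hunr hqp ht y
  rw [forall_apply_eq_iff_of_isFrobPow (GaloisRep.toLocal q (κ.twistModP ρ hM J)) hI hFr x,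
    toLocal_twistModP_apply_of_mem_layerSubgroup_of_le ρ hM κ J q hJm hFrm x, funext_iff]

variable [Finite M] [Fact (Ideal.absNorm q.asIdeal).Prime]
  [NeZero ((Ideal.absNorm q.asIdeal : ℕ) : q.adicCompletion K)]

/-- **The value of ANY local cocycle at an inertia element is slotwise `ρ(res Fr)`-fixed** at a
shallow prime (`φ(t₀) ∈ (𝒯_J|_q)^{Γ_{K_q}}` by `apply_cocycle_apply_eq_self_of_mem_absInertia`, and
`Fr` acts slotwise). [cite: Rubin2011, Prop. 1.9.5 (1) (p. 16)] -/
theorem cocycle_apply_slot_eq_self (hunr : GaloisRep.IsUnramifiedAt q ρ) (hqp : (p : 𝓞 K) ∉ q.asIdeal)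
    (hpl : p ∣ Ideal.absNorm q.asIdeal - 1)
    (hχI : ∀ u : (ZMod (Ideal.absNorm q.asIdeal))ˣ, ∃ t ∈ absInertia (q.adicCompletion K),
      modPCyclotomicCharacterZMod (q.adicCompletion K) (Ideal.absNorm q.asIdeal) t = u)
    {Fr : absoluteGaloisGroup (q.adicCompletion K)} {m : ℕ} (hJm : J ≤ p ^ m)
    (hFrm : absGaloisRestrict K (q.adicCompletion K) Fr ∈ κ.layerSubgroup m)
    (φ : contOneCocycles (GaloisRep.toLocal q (κ.twistModP ρ hM J)).toTopRep)
    {t₀ : absoluteGaloisGroup (q.adicCompletion K)} (ht₀ : t₀ ∈ absInertia (q.adicCompletion K))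
    (i : Fin J) :
    ρ (absGaloisRestrict K (q.adicCompletion K) Fr) (φ.1 t₀ i) = φ.1 t₀ i := by
  have hI : ∀ t ∈ absInertia (q.adicCompletion K), ∀ x : Fin J → M,
      GaloisRep.toLocal q (κ.twistModP ρ hM J) t x = x :=
    fun _ ht x => toLocal_twistModP_apply_of_mem_absInertia ρ hM κ J q hunr hqp ht x
  have hfix : GaloisRep.toLocal q (κ.twistModP ρ hM J) Fr (φ.1 t₀) = φ.1 t₀ :=
    apply_cocycle_apply_eq_self_of_mem_absInertia _ (Ideal.absNorm q.asIdeal)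
      (ringChar_residueField_adicCompletion_eq q) hI (sub_one_smul_eq_zero_of_dvd hM hpl) hχI φ ht₀ Fr
  rw [toLocal_twistModP_apply_of_mem_layerSubgroup_of_le ρ hM κ J q hJm hFrm] at hfix
  exact congrFun hfix i

/-- **A transverse class with prescribed slotwise-fixed value** at a shallow prime: for every `x` with
`ρ(res Fr) x_i = x_i` (an arbitrary element of `(𝒯_J|_q)^{Γ_{K_q}}`) there is a cocycle `φ` whose class
is `K_q(μ_ℓ)`-transverse and whose value at the tame generator `t₀` is `x`
(`H¹_tr ≃+ (𝒯_J|_q)^{Γ}` by evaluation at `t₀`, `exists_transverseSubgroup_addEquiv_invariants`).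
[cite: Rubin2011, Prop. 1.9.5 (1) (p. 16)] [cite: MazurRubin2004, Lemma 1.2.1] -/
theorem exists_transverse_cocycle_apply_eq_of_forall (hunr : GaloisRep.IsUnramifiedAt q ρ)
    (hqp : (p : 𝓞 K) ∉ q.asIdeal) (hpl : p ∣ Ideal.absNorm q.asIdeal - 1)
    (hχI : ∀ u : (ZMod (Ideal.absNorm q.asIdeal))ˣ, ∃ t ∈ absInertia (q.adicCompletion K),
      modPCyclotomicCharacterZMod (q.adicCompletion K) (Ideal.absNorm q.asIdeal) t = u)
    {Fr : absoluteGaloisGroup (q.adicCompletion K)} (hFr : IsAbsArithFrob Fr) {m : ℕ} (hJm : J ≤ p ^ m)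
    (hFrm : absGaloisRestrict K (q.adicCompletion K) Fr ∈ κ.layerSubgroup m)
    {t₀ : absoluteGaloisGroup (q.adicCompletion K)} (ht₀ : t₀ ∈ absInertia (q.adicCompletion K))
    (hgen : ∀ u : (ZMod (Ideal.absNorm q.asIdeal))ˣ,
      u ∈ Subgroup.zpowers (modPCyclotomicCharacterZMod (q.adicCompletion K) (Ideal.absNorm q.asIdeal) t₀))
    (x : Fin J → M) (hx : ∀ i, ρ (absGaloisRestrict K (q.adicCompletion K) Fr) (x i) = x i) :
    ∃ φ : contOneCocycles (GaloisRep.toLocal q (κ.twistModP ρ hM J)).toTopRep,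
      oneCocycleClass _ φ ∈ DiscreteGaloisModule.transverseSubgroup (GaloisRep.toLocal q (κ.twistModP ρ hM J))
        (CyclotomicField (Ideal.absNorm q.asIdeal) (q.adicCompletion K)) ∧
      φ.1 t₀ = x := by
  have hI : ∀ t ∈ absInertia (q.adicCompletion K), ∀ y : Fin J → M,
      GaloisRep.toLocal q (κ.twistModP ρ hM J) t y = y :=
    fun _ ht y => toLocal_twistModP_apply_of_mem_absInertia ρ hM κ J q hunr hqp ht y
  obtain ⟨e, he⟩ := exists_transverseSubgroup_addEquiv_invariants
    (GaloisRep.toLocal q (κ.twistModP ρ hM J)) (Ideal.absNorm q.asIdeal)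
    (ringChar_residueField_adicCompletion_eq q) hI (sub_one_smul_eq_zero_of_dvd hM hpl) hχI ht₀ hgen
  have hv : x ∈ (GaloisRep.toLocal q (κ.twistModP ρ hM J)).toTopRep.ρ.invariants :=
    fun g => (forall_toLocal_twistModP_apply_eq_self_iff_of_le ρ hM κ J q hunr hqp
      (IsAbsArithFrob.isFrobPow_holds hFr) hJm hFrm x).2 hx g
  set c := e.symm ⟨_, hv⟩ with hc
  obtain ⟨φ, hφ⟩ := oneCocycleClass_surjective _ c.1
  have hφtr : oneCocycleClass _ φ ∈ DiscreteGaloisModule.transverseSubgroup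
      (GaloisRep.toLocal q (κ.twistModP ρ hM J))
      (CyclotomicField (Ideal.absNorm q.asIdeal) (q.adicCompletion K)) := by
    rw [hφ]; exact c.2
  refine ⟨φ, hφtr, ?_⟩
  have h1 : (⟨oneCocycleClass _ φ, hφtr⟩ : DiscreteGaloisModule.transverseSubgroup
      (GaloisRep.toLocal q (κ.twistModP ρ hM J))
      (CyclotomicField (Ideal.absNorm q.asIdeal) (q.adicCompletion K))) = c := Subtype.ext hφ
  rw [← he φ hφtr, h1, hc, AddEquiv.apply_symm_apply]

end Shallow

/-! ## §2 `E[2]` under a transposition, and the values of local cocycles of `𝒯_J(E)` at `p = 2` -/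

/-- An involution `≠ 1` of three letters is a transposition: it fixes exactly one letter `i`, and for a
moved letter `j` the frame vectors satisfy `v_{s j} + v_j = v_i` (`v₀ + v₁ + v₂ = 0`). A decidable fact
about `S₃`. [folklore] -/
theorem perm_fin_three_exists_of_ne_one_of_mul_self_eq_one :
    ∀ s : Equiv.Perm (Fin 3), s ≠ 1 → s * s = 1 →
      ∃ i : Fin 3, s i = i ∧ (∀ j : Fin 3, s j = j → j = i) ∧
        (∀ j : Fin 3, s j ≠ j → vec (s j) + vec j = vec i) := by
  decide

/-- In `ZMod 2` a non-zero element is `1`. [folklore] -/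
theorem zmod_two_eq_one_of_ne_zero : ∀ x : ZMod 2, x ≠ 0 → x = 1 := by
  decide

section Slot

variable (W : WeierstrassCurve ℚ) [W.IsElliptic]

/-- **`E[2]` under a TRANSPOSITION.** For `g ∈ Γ_ℚ` with `ρ̄₂(g) ≠ 1`, `ρ̄₂(g²) = 1` (so `g` induces an
involution `≠ 1`, i.e. a transposition, of `{T₀, T₁, T₂}`): there is `P₀ ≠ 0` in `E[2]` (the fixed
letter) with `ker(g − 1) = {0, P₀}` and `g a − a = P₀` for every moved `a` — so `im(g − 1) = ker(g − 1)`
is the LINE `{0, P₀}` (`E[2] ≅ 𝔽₂[⟨g⟩]`). [cite: SilvermanAEC2009, Cor. III.6.4(b)] -/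
theorem exists_fixedPoint_of_transposition {g : absoluteGaloisGroup ℚ}
    (hT1 : galoisRepTorsion W 2 g ≠ 1) (hT2 : galoisRepTorsion W 2 (g * g) = 1) :
    ∃ P₀ : geomTorsion W 2, P₀ ≠ 0 ∧ (∀ a : geomTorsion W 2, g • a = a ↔ a = 0 ∨ a = P₀) ∧
      ∀ a : geomTorsion W 2, g • a ≠ a → g • a - a = P₀ := by
  have h2 : (2 : ℚ) ≠ 0 := two_ne_zero
  have hs1 : permGal W h2 g ≠ 1 := fun h =>
    hT1 ((mem_ker_galoisRepTorsion_two_iff W g).2 ((forall_smul_eq_iff_permGal_eq_one W g).2 h))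
  have hs2 : permGal W h2 g * permGal W h2 g = 1 := by
    rw [← permGal_mul]
    exact (forall_smul_eq_iff_permGal_eq_one W (g * g)).1 ((mem_ker_galoisRepTorsion_two_iff W (g * g)).1 hT2)
  obtain ⟨i, hi, huniq, hmove⟩ := perm_fin_three_exists_of_ne_one_of_mul_self_eq_one _ hs1 hs2
  have hTi : T W h2 i ≠ 0 := fun h => coe_T_ne_zero W h2 i (by rw [h]; rfl)
  refine ⟨T W h2 i, hTi, fun a => ?_, fun a ha => ?_⟩
  · rcases eq_zero_or_eq_T W h2 a with rfl | ⟨j, rfl⟩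
    · simp only [smul_zero, true_or]
    · rw [← T_permGal]
      constructor
      · intro h
        exact Or.inr (congrArg _ (huniq j (T_injective W h2 h)))
      · rintro (h | h)
        · exact absurd h fun h' => coe_T_ne_zero W h2 j (by rw [h']; rfl)
        · have hji : j = i := T_injective W h2 h
          rw [hji, hi]
  · rcases eq_zero_or_eq_T W h2 a with rfl | ⟨j, rfl⟩
    · exact absurd (smul_zero g) ha
    · have hj : permGal W h2 g j ≠ j := fun h => ha (by rw [← T_permGal, h])
      rw [← T_permGal, sub_eq_add_neg, neg_eq_self_geomTorsion_two]
      apply (frame W h2).injective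
      rw [map_add, frame_T_eq_vec, frame_T_eq_vec, frame_T_eq_vec]
      exact hmove j hj

variable (eW : geomTorsion W (2 : ℤ) → geomTorsion W (2 : ℤ) → AlgebraicClosure ℚ)
  (hμ : ∀ S T, eW S T ^ 2 = 1) (hadd₁ : ∀ S₁ S₂ T, eW (S₁ + S₂) T = eW S₁ T * eW S₂ T)
  (hadd₂ : ∀ S T₁ T₂, eW S (T₁ + T₂) = eW S T₁ * eW S T₂)

omit [W.IsElliptic] in
/-- **The fixed line is its own orthogonal**: for a non-degenerate alternating `e` on `E[2]` and the
fixed point `P₀ ≠ 0` of a transposition `g` (`ker(g − 1) = {0, P₀} = im(g − 1)`), `e(P₀, b) = 0 ↔ g b = b`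
(`⇐`: `e(P₀, 0) = e(P₀, P₀) = 0`; `⇒`: otherwise `e(P₀, ·)` would vanish on `b + ker(g − 1) ∪ ker(g − 1)
= E[2]`, contradicting non-degeneracy). [cite: SilvermanAEC2009, Prop. III.8.1] -/
theorem weilPairingHom_eq_zero_iff_smul_eq_of_transposition (halt : ∀ T, eW T T = 1)
    (hnondeg : ∀ T, (∀ S, eW S T = 1) → T = 0) {g : absoluteGaloisGroup ℚ} {P₀ : geomTorsion W 2}
    (hP₀ : P₀ ≠ 0) (hker : ∀ a : geomTorsion W 2, g • a = a ↔ a = 0 ∨ a = P₀)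
    (him : ∀ a : geomTorsion W 2, g • a ≠ a → g • a - a = P₀) (b : geomTorsion W 2) :
    weilPairingHom W 2 eW hμ hadd₁ hadd₂ P₀ b = 0 ↔ g • b = b := by
  have h0 : ∀ c : geomTorsion W 2, g • c = c → weilPairingHom W 2 eW hμ hadd₁ hadd₂ P₀ c = 0 := by
    intro c hc
    rcases (hker c).1 hc with rfl | rfl
    · exact map_zero _
    · exact weilPairingHom_self W 2 eW hμ hadd₁ hadd₂ halt _
  refine ⟨fun hb => ?_, h0 b⟩
  by_contra hgb
  apply hP₀
  refine (injective_iff_map_eq_zero _).1 (weilPairingHom_injective W 2 eW hμ hadd₁ hadd₂ halt hnondeg) P₀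
    (AddMonoidHom.ext fun c => ?_)
  rw [AddMonoidHom.zero_apply]
  by_cases hc : g • c = c
  · exact h0 c hc
  · -- `g(c − b) = c − b`, since `g c − c = P₀ = g b − b`
    have hcb : g • (c - b) = c - b := by
      rw [smul_sub, sub_eq_sub_iff_sub_eq_sub, him c hc, him b hgb]
    have h := h0 (c - b) hcb
    rwa [map_sub, hb, sub_zero] at h

end Slot

section CurveValues

variable (W : WeierstrassCurve ℚ) [W.IsElliptic] (κ : ZpExtension ℚ 2) (J : ℕ)
  (q : HeightOneSpectrum (𝓞 ℚ)) [Fact (Ideal.absNorm q.asIdeal).Prime]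
  [NeZero ((Ideal.absNorm q.asIdeal : ℕ) : q.adicCompletion ℚ)]

/-- **Values at a transposition prime, `p = 2`**: every local cocycle `φ` of
`𝒯_J(E)|_q = (κ.twistModP E[2] J)|_{Γ_{ℚ_q}}` (for `q ∤ 2` with `E[2]` unramified, `J ≤ 2^m`,
`res Fr ∈ Γ_m`, `ρ̄₂(res Fr)` a transposition) has `φ(t₀) = (g − 1)v` slotwise for some `v`
(`φ(t₀)` is slotwise `g`-fixed and `ker(g − 1) = im(g − 1)` on `E[2]`), `g = res Fr`.
[cite: Rubin2011, Prop. 1.9.5 (1) (p. 16)] [cite: SilvermanAEC2009, Cor. III.6.4(b)] -/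
theorem exists_cocycle_apply_eq_smul_sub_two
    (hunr : GaloisRep.IsUnramifiedAt q (W.torsionGaloisModule (2 : ℤ)))
    (hqp : ((2 : ℕ) : 𝓞 ℚ) ∉ q.asIdeal) (hpl : 2 ∣ Ideal.absNorm q.asIdeal - 1)
    (hχI : ∀ u : (ZMod (Ideal.absNorm q.asIdeal))ˣ, ∃ t ∈ absInertia (q.adicCompletion ℚ),
      modPCyclotomicCharacterZMod (q.adicCompletion ℚ) (Ideal.absNorm q.asIdeal) t = u)
    {Fr : absoluteGaloisGroup (q.adicCompletion ℚ)}
    (hT1 : galoisRepTorsion W 2 (absGaloisRestrict ℚ (q.adicCompletion ℚ) Fr) ≠ 1)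
    (hT2 : galoisRepTorsion W 2
      (absGaloisRestrict ℚ (q.adicCompletion ℚ) Fr * absGaloisRestrict ℚ (q.adicCompletion ℚ) Fr) = 1)
    {m : ℕ} (hJm : J ≤ 2 ^ m) (hFrm : absGaloisRestrict ℚ (q.adicCompletion ℚ) Fr ∈ κ.layerSubgroup m)
    (φ : contOneCocycles (GaloisRep.toLocal q (κ.twistModP (W.torsionGaloisModule (2 : ℤ))
      (fun P : geomTorsion W (2 : ℤ) => AddSubgroup.torsionBy.nsmul P) J)).toTopRep)
    {t₀ : absoluteGaloisGroup (q.adicCompletion ℚ)} (ht₀ : t₀ ∈ absInertia (q.adicCompletion ℚ)) :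
    ∃ v : Fin J → geomTorsion W (2 : ℤ),
      φ.1 t₀ = fun i => absGaloisRestrict ℚ (q.adicCompletion ℚ) Fr • v i - v i := by
  haveI : Finite (geomTorsion W (2 : ℤ)) := finite_geomTorsion_of_neZero W 2
  obtain ⟨P₀, -, hker, him⟩ := exists_fixedPoint_of_transposition W hT1 hT2
  have hfix : ∀ i, absGaloisRestrict ℚ (q.adicCompletion ℚ) Fr • φ.1 t₀ i = φ.1 t₀ i := fun i => by
    have h := cocycle_apply_slot_eq_self (W.torsionGaloisModule (2 : ℤ))
      (fun P : geomTorsion W (2 : ℤ) => AddSubgroup.torsionBy.nsmul P) κ J q hunr hqp hpl hχI hJm hFrm φ ht₀ i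
    rwa [torsionGaloisModule_apply_apply] at h
  -- `ker(g − 1) ⊆ im(g − 1)`: `0 = g0 − 0`, `P₀ = gQ − Q` for any moved `Q`
  obtain ⟨Q, hQ⟩ : ∃ Q : geomTorsion W 2, absGaloisRestrict ℚ (q.adicCompletion ℚ) Fr • Q ≠ Q := by
    by_contra h
    push Not at h
    exact hT1 ((mem_ker_galoisRepTorsion_two_iff W _).2 h)
  have hval : ∀ i, ∃ v : geomTorsion W (2 : ℤ),
      φ.1 t₀ i = absGaloisRestrict ℚ (q.adicCompletion ℚ) Fr • v - v := fun i => by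
    rcases (hker _).1 (hfix i) with h | h
    · exact ⟨0, by rw [h, smul_zero, sub_zero]⟩
    · exact ⟨Q, by rw [h, him Q hQ]⟩
  choose v hv using hval
  exact ⟨v, funext hv⟩

/-- **Transverse classes with prescribed `(g − 1)`-value, `p = 2`**: for every `v` there is a local
cocycle `φ` of `𝒯_J(E)|_q` with TRANSVERSE class and `φ(t₀) = (g − 1)v` slotwise (`(g − 1)v` is
slotwise `g`-fixed since `(g − 1)² = 0` on `E[2]`: `im(g − 1) ⊆ ker(g − 1)`).
[cite: Rubin2011, Prop. 1.9.5 (1) (p. 16)] [cite: SilvermanAEC2009, Cor. III.6.4(b)] -/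
theorem exists_transverse_cocycle_apply_eq_smul_sub_two
    (hunr : GaloisRep.IsUnramifiedAt q (W.torsionGaloisModule (2 : ℤ)))
    (hqp : ((2 : ℕ) : 𝓞 ℚ) ∉ q.asIdeal) (hpl : 2 ∣ Ideal.absNorm q.asIdeal - 1)
    (hχI : ∀ u : (ZMod (Ideal.absNorm q.asIdeal))ˣ, ∃ t ∈ absInertia (q.adicCompletion ℚ),
      modPCyclotomicCharacterZMod (q.adicCompletion ℚ) (Ideal.absNorm q.asIdeal) t = u)
    {Fr : absoluteGaloisGroup (q.adicCompletion ℚ)} (hFr : IsAbsArithFrob Fr)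
    (hT1 : galoisRepTorsion W 2 (absGaloisRestrict ℚ (q.adicCompletion ℚ) Fr) ≠ 1)
    (hT2 : galoisRepTorsion W 2
      (absGaloisRestrict ℚ (q.adicCompletion ℚ) Fr * absGaloisRestrict ℚ (q.adicCompletion ℚ) Fr) = 1)
    {m : ℕ} (hJm : J ≤ 2 ^ m) (hFrm : absGaloisRestrict ℚ (q.adicCompletion ℚ) Fr ∈ κ.layerSubgroup m)
    {t₀ : absoluteGaloisGroup (q.adicCompletion ℚ)} (ht₀ : t₀ ∈ absInertia (q.adicCompletion ℚ))
    (hgen : ∀ u : (ZMod (Ideal.absNorm q.asIdeal))ˣ,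
      u ∈ Subgroup.zpowers (modPCyclotomicCharacterZMod (q.adicCompletion ℚ) (Ideal.absNorm q.asIdeal) t₀))
    (v : Fin J → geomTorsion W (2 : ℤ)) :
    ∃ φ : contOneCocycles (GaloisRep.toLocal q (κ.twistModP (W.torsionGaloisModule (2 : ℤ))
      (fun P : geomTorsion W (2 : ℤ) => AddSubgroup.torsionBy.nsmul P) J)).toTopRep,
      oneCocycleClass _ φ ∈ DiscreteGaloisModule.transverseSubgroup
        (GaloisRep.toLocal q (κ.twistModP (W.torsionGaloisModule (2 : ℤ))
          (fun P : geomTorsion W (2 : ℤ) => AddSubgroup.torsionBy.nsmul P) J))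
        (CyclotomicField (Ideal.absNorm q.asIdeal) (q.adicCompletion ℚ)) ∧
      φ.1 t₀ = fun i => absGaloisRestrict ℚ (q.adicCompletion ℚ) Fr • v i - v i := by
  haveI : Finite (geomTorsion W (2 : ℤ)) := finite_geomTorsion_of_neZero W 2
  obtain ⟨P₀, -, hker, him⟩ := exists_fixedPoint_of_transposition W hT1 hT2
  refine exists_transverse_cocycle_apply_eq_of_forall (W.torsionGaloisModule (2 : ℤ))
    (fun P : geomTorsion W (2 : ℤ) => AddSubgroup.torsionBy.nsmul P) κ J q hunr hqp hpl hχI hFr hJm hFrm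
    ht₀ hgen _ fun i => ?_
  rw [torsionGaloisModule_apply_apply]
  -- `im(g − 1) ⊆ ker(g − 1)`
  by_cases h : absGaloisRestrict ℚ (q.adicCompletion ℚ) Fr • v i = v i
  · rw [h, sub_self, smul_zero]
  · rw [him _ h]
    exact (hker P₀).2 (Or.inr rfl)

end CurveValues

end Summit.BirchSwinnertonDyer.BirchSwinnertonDyer.Theorems.SteinbergFibreAtTwo

end
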